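import Mathlib.MeasureTheory.Measure.Lebesgue.Integral
import Literature.NumberTheory.LFunctions.PolyaKernelRH
import Literature.NumberTheory.LFunctions.DeBruijnNewmanConstProofs
import HarnessLib

/-!
# Imaginary zeros of the Laplace transform of `Φ` imply RH — proof

Topic: NumberTheory/LFunctions (trunk T-ANT). Companion ("Proofs") file of
`Literature.NumberTheory.LFunctions.PolyaKernelRH`, discharging its single named fact
`Literature.NumberTheory.LFunctions.riemannHypothesis_of_deBruijnPhi_laplace_zeros` (route `RiemannHypothesis/LeeYang`,
assembly item): if every zero of `z ↦ ∫_ℝ e^{zu} Φ(u) du` (`Φ = Literature.deBruijnPhi`, the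
Pólya–de Bruijn kernel in the Rodgers–Tao normalisation) is purely imaginary, then the Riemann
hypothesis holds.

## Proof (Pólya 1926; Titchmarsh §10.1; Edwards §1.8)

* `Literature.NumberTheory.LFunctions.integral_exp_mul_deBruijnPhi` : `∫_ℝ e^{zu} Φ(u) du = 2 H_0(iz)` for every `z : ℂ`,
  where `H_0(w) = ∫₀^∞ Φ(u) cos(wu) du` (`Literature.deBruijnH 0`). The integrand is integrable on `ℝ`
  (`Φ` is continuous, even — `Literature.NumberTheory.LFunctions.deBruijnPhi_neg_holds` — and `|Φ(u)| e^{Y u}` is integrable on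
  `(0, ∞)`, `Literature.NumberTheory.LFunctions.integrableOn_deBruijnHBound`); splitting `ℝ = (−∞, 0] ∪ (0, ∞)` and reflecting
  the first piece gives `∫₀^∞ (e^{zu} + e^{−zu}) Φ(u) du = 2 ∫₀^∞ Φ(u) cosh(zu) du`, and
  `cosh(zu) = cos(izu)`.
* Pólya / Titchmarsh §10.1: `H_0(w) = ξ(½ + iw/2)/8` (in-tree, proved:
  `Literature.NumberTheory.LFunctions.deBruijnH_zero_eq_holds`), whence RH `↔` all zeros of `H_0` are real (in-tree, proved:
  `Literature.NumberTheory.LFunctions.riemannHypothesis_iff_hasOnlyRealZeros_deBruijnH_zero_holds`). If `H_0(w) = 0`, then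
  `z = −iw` is a zero of the Laplace transform, so `re z = im w = 0`.

## References

* G. Pólya, *Bemerkung über die Integraldarstellung der Riemannschen ξ-Funktion*, Acta Math. 48
  (1926), 305–317, doi:10.1007/BF02565336 (Riemann's integral representation of `Ξ` as a cosine
  transform of the even kernel `Φ`; paywalled, not held — the equation locators below are read
  from Titchmarsh and Edwards).
* E. C. Titchmarsh, *The Theory of the Riemann Zeta-Function*, 2nd ed. (1986), §10.1,
  (10.1.1)–(10.1.4): `Ξ(t) = 2∫₀^∞ Φ_T(u) cos(ut) du`, `Φ_T` even; in the Rodgers–Tao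
  normalisation used in-tree `Φ(u) = Φ_T(2u)/2`, `H_0(z) = Ξ(z/2)/8`.
* H. M. Edwards, *Riemann's Zeta Function* (1974), §1.8, eq. (2) (p. 30).
-/

noncomputable section

open Complex MeasureTheory Real Set

namespace Literature.NumberTheory.LFunctions

/-- The Laplace integrand `e^{zu} Φ(u)` is integrable on `(0, ∞)`: it is continuous and dominated
by `|Φ(u)| e^{|re z| u}` (`Literature.NumberTheory.LFunctions.integrableOn_deBruijnHBound` with `T = 0`). [folklore] -/
theorem integrableOn_exp_mul_deBruijnPhi_Ioi (z : ℂ) :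
    IntegrableOn (fun u : ℝ ↦ cexp (z * u) * (deBruijnPhi u : ℂ)) (Ioi 0) := by
  have hc : Continuous fun u : ℝ ↦ cexp (z * u) * (deBruijnPhi u : ℂ) := by
    have := continuous_deBruijnPhi
    fun_prop
  refine (integrableOn_deBruijnHBound 0 |z.re|).mono' (hc.aestronglyMeasurable.restrict)
    (ae_restrict_of_forall_mem measurableSet_Ioi fun u (hu : 0 < u) ↦ ?_)
  rw [deBruijnHBound, zero_mul, Real.exp_zero, one_mul, norm_mul, Complex.norm_real,
    Real.norm_eq_abs, Complex.norm_exp, mul_comm]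
  gcongr
  rw [show (z * (u : ℂ)).re = z.re * u by simp]
  exact mul_le_mul_of_nonneg_right (le_abs_self _) hu.le

/-- The Laplace integrand `e^{zu} Φ(u)` is integrable on `(−∞, 0]`, by reflection `u ↦ −u` and
the evenness of `Φ`. [folklore] -/
theorem integrableOn_exp_mul_deBruijnPhi_Iic (z : ℂ) :
    IntegrableOn (fun u : ℝ ↦ cexp (z * u) * (deBruijnPhi u : ℂ)) (Iic 0) := by
  rw [← Measure.map_neg_eq_self (volume : Measure ℝ)]
  let m : MeasurableEmbedding fun x : ℝ ↦ -x := (Homeomorph.neg ℝ).measurableEmbedding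
  rw [m.integrableOn_map_iff]
  simp_rw [Function.comp_def, neg_preimage, neg_Iic, neg_zero]
  have := integrableOn_exp_mul_deBruijnPhi_Ioi (-z)
  refine Iff.mpr integrableOn_Ici_iff_integrableOn_Ioi (this.congr_fun (fun u _ ↦ ?_) measurableSet_Ioi)
  simp only [deBruijnPhi_neg_holds u]
  push_cast
  ring_nf

/-- The Laplace integrand `e^{zu} Φ(u)` is integrable on `ℝ`. [folklore] -/
theorem integrable_exp_mul_deBruijnPhi (z : ℂ) :
    Integrable (fun u : ℝ ↦ cexp (z * u) * (deBruijnPhi u : ℂ)) := by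
  rw [← integrableOn_univ, ← Iic_union_Ioi (a := (0 : ℝ)), integrableOn_union]
  exact ⟨integrableOn_exp_mul_deBruijnPhi_Iic z, integrableOn_exp_mul_deBruijnPhi_Ioi z⟩

/-- **Two-sided Laplace transform of `Φ`** (Pólya 1926; Titchmarsh §10.1, (10.1.3)–(10.1.4);
Edwards §1.8 eq. (2)): `∫_ℝ e^{zu} Φ(u) du = 2 ∫₀^∞ Φ(u) cosh(zu) du = 2 H_0(iz)`, since `Φ` is
even.
[cite: Titchmarsh1986, §10.1 eqs. (10.1.3)–(10.1.4)] -/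
theorem integral_exp_mul_deBruijnPhi (z : ℂ) :
    ∫ u : ℝ, cexp (z * u) * (deBruijnPhi u : ℂ) = 2 * deBruijnH 0 (I * z) := by
  set g : ℝ → ℂ := fun u ↦ cexp (z * u) * (deBruijnPhi u : ℂ) with hg
  have hIoi := integrableOn_exp_mul_deBruijnPhi_Ioi z
  have hIoi' := integrableOn_exp_mul_deBruijnPhi_Ioi (-z)
  have hIic := integrableOn_exp_mul_deBruijnPhi_Iic z
  have h1 : ∫ u : ℝ, g u = (∫ u in Iic (0 : ℝ), g u) + ∫ u in Ioi (0 : ℝ), g u := by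
    rw [← setIntegral_union (Iic_disjoint_Ioi le_rfl) measurableSet_Ioi hIic hIoi,
      Iic_union_Ioi, Measure.restrict_univ]
  have h2 : ∫ u in Iic (0 : ℝ), g u = ∫ u in Ioi (0 : ℝ), cexp (-z * u) * (deBruijnPhi u : ℂ) := by
    rw [← neg_zero, ← integral_comp_neg_Iic, neg_zero]
    refine setIntegral_congr_fun measurableSet_Iic fun u _ ↦ ?_
    simp only [hg, deBruijnPhi_neg_holds u]
    push_cast
    ring_nf
  rw [h1, h2, ← integral_add hIoi' hIoi, deBruijnH_eq_integral, ← integral_const_mul]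
  refine setIntegral_congr_fun measurableSet_Ioi fun u _ ↦ ?_
  simp only [deBruijnHIntegrand, zero_mul, Real.exp_zero, neg_mul,
    show I * z * (u : ℂ) = z * u * I by ring, Complex.cos_mul_I, ← mul_assoc]
  push_cast
  linear_combination (-(deBruijnPhi u : ℂ)) * Complex.two_cosh (z * u)

/-- **Discharge of `Literature.NumberTheory.LFunctions.riemannHypothesis_of_deBruijnPhi_laplace_zeros`** (Pólya 1926 /
Titchmarsh §10.1): if all zeros of `z ↦ ∫_ℝ e^{zu} Φ(u) du = 2 H_0(iz)` are purely imaginary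
then all zeros of `H_0 = ξ(½ + i·/2)/8` are real, which is the Riemann hypothesis
(`Literature.NumberTheory.LFunctions.riemannHypothesis_iff_hasOnlyRealZeros_deBruijnH_zero_holds`).
[cite: Polya1926, pp. 305–317 (integral representation of Ξ)]
[cite: Titchmarsh1986, §10.1 eqs. (10.1.3)–(10.1.4)] [cite: Edwards1974, §1.8 eq. (2)] -/
theorem riemannHypothesis_of_deBruijnPhi_laplace_zeros_holds :
    riemannHypothesis_of_deBruijnPhi_laplace_zeros := by
  intro h
  refine riemannHypothesis_iff_hasOnlyRealZeros_deBruijnH_zero_holds.mpr fun w hw ↦ ?_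
  have hz : (∫ u : ℝ, cexp (-I * w * u) * (deBruijnPhi u : ℂ)) = 0 := by
    rw [integral_exp_mul_deBruijnPhi, ← mul_assoc, show I * -I = 1 by simp, one_mul, hw,
      mul_zero]
  simpa using h (-I * w) hz

end Literature.NumberTheory.LFunctions
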